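import Mathlib
import HarnessLib
import Literature.Combinatorics.Additive.HamidouneRodsethSumsetComponents

/-!
# Hamidoune–Rødseth's inverse theorem mod `p`, IV: Lemma 8 (Case III) and Theorem 3

Topic `Literature/Combinatorics/Additive`.  Sequel of `HamidouneRodsethRuns.lean`,
`HamidouneRodsethLemmas.lean`, `HamidouneRodsethSumsetComponents.lean`; source Y. O. Hamidoune,
Ø. J. Rødseth, *An inverse theorem mod p*, Acta Arith. 92 (2000) 251–262, §4 Lemma 8 and §5 (pp. 259–261 of
the printed paper, read from the publisher's open copy `paper:url-91a40b2366eb`).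

* `false_of_three_one` — the computation shared by Cases III.1/III.2 of Lemma 8 (p. 260): for
  `B = {b₁, b₁ + d, b₁ + 2d} ∪ {b₂}` with `2(b₂ − b₁) ∈ {0, d, 2d, 3d, 4d}`, either `b₂` collides with the run
  or `B = {0, 1/2, 1, 2}` / `{0, 1, 3/2, 2}` (in units of `d`) is an almost progression of difference
  `d/2` — "a contradiction";
* `offset_of_union_three_three` — two 3-runs whose union is a run of `L` terms sit at offset `L − 3`;
* **Lemma 8, Case III** (`|A| = |B| = 4`, p. 260–261): `false_of_card_four` — with both `A` and `B` double
  `d`-progressions that are not almost progressions for ANY difference, `|A + B| = 8 ≤ p − 4` is impossible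
  (sub-cases III.1, III.2 and its mirror, III.3.1, III.3.2, on top of Lemma 7);
* **Theorem 3** (p. 252 / §5 p. 261), MODULO its `min(|A|, |B|) = 3` layer:
  `hamidouneRodseth_of_card_three` — if the theorem holds whenever `|A| = 3`, then for all
  `|A|, |B| ≥ 3` with `7 ≤ |A + B| = |A| + |B| ≤ p − 4`, `A` and `B` are almost progressions with a common
  (non-zero) difference.  The induction is the printed one (§5): strip `{0, d}` off the larger set using
  Lemma 6 (both components have `≥ 2` points when `|A| ≥ 5`), `k = 2` by Cauchy–Davenport/Vosper/Lemma 3,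
  and conclude with Lemma 5; the base of the printed induction is Lemma 8, whose Cases I–II
  (`(|A|, |B|) = (4, 3), (5, 3)`) are exactly the `|B| = 3` layer taken here as the hypothesis `h3`, and whose
  Case III is `false_of_card_four`.

The `|S| = 3` layer is the object of a separate formalisation (pub-omega seat stpp-2, `HamidouneRodsethCard 3`
in `Summits/MatrixMultiplication/OmegaCensus/`); with it, `hamidouneRodseth_of_card_three` yields the printed
Theorem 3 in full.  Census-silent (pub-omega, seat stpp-1 gen 31).
-/

namespace Literature.Combinatorics.Additive

open Finset
open scoped Pointwise

namespace HamidouneRodseth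

variable {p : ℕ} [hp : Fact p.Prime]

/-! ## Halving in `ℤ/pℤ`, `p` odd -/

/-- `2 ≠ 0` in `ℤ/pℤ` for `p ≥ 3`. [cite: Nathanson1996, §2.5 (arithmetic progressions in ℤ/pℤ)] -/
theorem two_ne_zero_of_three_le (hp3 : 3 ≤ p) : (2 : ZMod p) ≠ 0 := by
  intro h
  have h' : ((2 : ℕ) : ZMod p) = 0 := by exact_mod_cast h
  have hdvd : p ∣ 2 := (CharP.cast_eq_zero_iff (ZMod p) p 2).1 h'
  have := Nat.le_of_dvd (by norm_num) hdvd
  omega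

/-- Halving: `x + x = y + y ⇒ x = y` in `ℤ/pℤ`, `p ≥ 3`. [cite: HamidouneRodseth2000, §4 Lemma 8 (p. 259:
"`v = 1/2` or `v = 3/2`")] -/
theorem eq_of_add_self_eq (hp3 : 3 ≤ p) {x y : ZMod p} (h : x + x = y + y) : x = y := by
  have h2 : (2 : ZMod p) * (x - y) = 0 := by linear_combination h
  rcases mul_eq_zero.1 h2 with h | h
  · exact absurd h (two_ne_zero_of_three_le hp3)
  · exact sub_eq_zero.1 h

/-! ## The shared computation of Cases III.1 / III.2 -/

/-- **Cases III.1/III.2 of Lemma 8, the final computation** (p. 260): `B = {b₁, b₁ + d, b₁ + 2d} ∪ {b₂}` with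
`b₂` outside the run, `B` not an almost progression for any difference, and `2(b₂ − b₁) = t d` with
`t ≤ 4`: impossible ("`u + v = 0, 1, 2, 3,` or `4`, and `u = v`.  It follows that `v = 1/2` or `3/2`, so that
`B = {0, 1/2, 1, 2}` or `B = {0, 1, 3/2, 2}`, a contradiction").
[cite: HamidouneRodseth2000, §4 Lemma 8, Case III.1 (p. 260)] -/
theorem false_of_three_one {B : Finset (ZMod p)} {d b₁ b₂ : ZMod p} (hd : d ≠ 0) (hp3 : 3 ≤ p)
    (hB : B = apFinset b₁ d 3 ∪ {b₂}) (hb₂ : b₂ ∉ apFinset b₁ d 3)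
    (hBna : ∀ e b : ZMod p, e ≠ 0 → ¬ B ⊆ apFinset b e 5) {t : ℕ} (ht : t ≤ 4)
    (hv : (b₂ - b₁) + (b₂ - b₁) = t • d) : False := by
  have memrun : ∀ i < 3, b₁ + i • d ∈ apFinset b₁ d 3 := fun i hi => mem_apFinset.2 ⟨i, hi, rfl⟩
  interval_cases t
  · -- `t = 0`: `b₂ = b₁`
    rw [zero_nsmul, ← add_zero (0 : ZMod p)] at hv
    have := eq_of_add_self_eq hp3 hv
    rw [sub_eq_zero] at this
    apply hb₂; rw [this]; simpa using memrun 0 (by norm_num)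
  · -- `t = 1`: `B ⊆ {b₁ + i v : i < 5}` with `2v = d`
    rw [one_nsmul] at hv
    set v := b₂ - b₁ with hvdef
    have hv0 : v ≠ 0 := by intro h; rw [h, add_zero] at hv; exact hd hv.symm
    apply hBna v b₁ hv0
    intro x hx
    rw [hB, mem_union, mem_singleton] at hx
    rcases hx with hx | rfl
    · obtain ⟨i, hi, rfl⟩ := mem_apFinset.1 hx
      refine mem_apFinset.2 ⟨2 * i, by omega, ?_⟩
      rw [mul_comm, mul_nsmul', two_nsmul, hv]
    · exact mem_apFinset.2 ⟨1, by omega, by rw [one_nsmul, hvdef, add_sub_cancel]⟩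
  · -- `t = 2`: `b₂ = b₁ + d`
    rw [two_nsmul] at hv
    have := eq_of_add_self_eq hp3 hv
    apply hb₂
    rw [show b₂ = b₁ + (1 : ℕ) • d by rw [one_nsmul, ← this, add_sub_cancel]]
    exact memrun 1 (by norm_num)
  · -- `t = 3`: `B ⊆ {b₁ + i w : i < 5}` with `2w = d`, `w = v − d`
    set w := b₂ - b₁ - d with hwdef
    have hw : w + w = d := by
      rw [hwdef]
      have : (3 : ℕ) • d = d + d + d := by rw [show (3 : ℕ) = 2 + 1 by norm_num, add_nsmul, two_nsmul, one_nsmul]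
      rw [this] at hv
      linear_combination hv
    have hw0 : w ≠ 0 := by intro h; rw [h, add_zero] at hw; exact hd hw.symm
    apply hBna w b₁ hw0
    intro x hx
    rw [hB, mem_union, mem_singleton] at hx
    rcases hx with hx | rfl
    · obtain ⟨i, hi, rfl⟩ := mem_apFinset.1 hx
      refine mem_apFinset.2 ⟨2 * i, by omega, ?_⟩
      rw [mul_comm, mul_nsmul', two_nsmul, hw]
    · refine mem_apFinset.2 ⟨3, by omega, ?_⟩
      have : (3 : ℕ) • w = w + w + w := by rw [show (3 : ℕ) = 2 + 1 by norm_num, add_nsmul, two_nsmul, one_nsmul]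
      rw [this, hw, hwdef]; abel
  · -- `t = 4`: `b₂ = b₁ + 2d`
    have h4 : (4 : ℕ) • d = (2 : ℕ) • d + (2 : ℕ) • d := by rw [← add_nsmul]
    rw [h4] at hv
    have := eq_of_add_self_eq hp3 hv
    apply hb₂
    rw [show b₂ = b₁ + (2 : ℕ) • d by rw [← this, add_sub_cancel]]
    exact memrun 2 (by norm_num)

/-! ## Two 3-runs filling a run -/

/-- If the union of two `3`-runs is a run of `L < p` terms, the two runs sit at offset `L − 3` from each other
(the first point of the big run starts one of them, its last point ends the other).
[cite: HamidouneRodseth2000, §4 Lemma 8, Case III.3 (pp. 260–261: "`u + v = ±2`", "`u + v = ±1`")] -/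
theorem offset_of_union_three_three {x y c d : ZMod p} (hd : d ≠ 0) {L : ℕ} (hLp : L < p)
    (hU : apFinset x d 3 ∪ apFinset y d 3 = apFinset c d L) :
    y = x + (L - 3) • d ∨ x = y + (L - 3) • d := by
  have hxs : apFinset x d 3 ⊆ apFinset c d L := hU ▸ subset_union_left
  have hys : apFinset y d 3 ⊆ apFinset c d L := hU ▸ subset_union_right
  obtain ⟨i, hix, hi⟩ := exists_offset_of_apFinset_subset hd (by norm_num) hLp hxs
  obtain ⟨j, hjy, hj⟩ := exists_offset_of_apFinset_subset hd (by norm_num) hLp hys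
  have hL3 : 3 ≤ L := by omega
  -- the first point of the big run
  have hc : c ∈ apFinset x d 3 ∪ apFinset y d 3 := by
    rw [hU]; exact mem_apFinset.2 ⟨0, by omega, by simp⟩
  -- the last point of the big run
  have hlast : c + (L - 1) • d ∈ apFinset x d 3 ∪ apFinset y d 3 := by
    rw [hU]; exact mem_apFinset.2 ⟨L - 1, by omega, rfl⟩
  -- index bookkeeping: a point `c + k • d` of `apFinset (c + i • d) d 3` has `i ≤ k ≤ i + 2`
  have idx : ∀ (i k : ℕ), i + 3 ≤ L → k < p → c + k • d ∈ apFinset (c + i • d) d 3 → i ≤ k ∧ k ≤ i + 2 := by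
    intro i k hi hk hmem
    obtain ⟨l, hl, hlk⟩ := mem_apFinset.1 hmem
    rw [add_assoc, ← add_nsmul] at hlk
    have := nat_eq_of_nsmul_eq hd (by omega) hk (add_left_cancel hlk)
    omega
  rw [mem_union, hix, hjy] at hc hlast
  have hc' : c = c + 0 • d := by rw [zero_nsmul, add_zero]
  have first : i = 0 ∨ j = 0 := by
    rcases hc with h | h
    · left; have := idx i 0 hi hp.out.pos (hc' ▸ h); omega
    · right; have := idx j 0 hj hp.out.pos (hc' ▸ h); omega
  have last : i + 3 = L ∨ j + 3 = L := by
    rcases hlast with h | h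
    · left; have := idx i (L - 1) hi (by omega) h; omega
    · right; have := idx j (L - 1) hj (by omega) h; omega
  rcases first with rfl | rfl
  · rw [zero_nsmul, add_zero] at hix
    subst hix
    rcases last with h | h
    · -- `L = 3`, so `j = 0` as well
      have hj0 : j = 0 := by omega
      subst hj0
      left; rw [hjy, show L - 3 = 0 by omega]
    · left; rw [hjy, show L - 3 = j by omega]
  · rw [zero_nsmul, add_zero] at hjy
    subst hjy
    rcases last with h | h
    · right; rw [hix, show L - 3 = i by omega]
    · have hi0 : i = 0 := by omega
      subst hi0
      right; rw [hix, show L - 3 = 0 by omega]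

/-! ## Lemma 8, Case III: `|A| = |B| = 4` -/

/-- **Lemma 8 of Hamidoune–Rødseth, Case III** (pp. 260–261): `|A| = |B| = 4`, `|A + B| = 8 ≤ p − 4`, `A` and
`B` double `d`-progressions (given by their two components) which are not almost progressions for ANY
difference: impossible.  Proof as printed, on top of Lemma 7 (`A + B = C₁ ⊔ C₂`, `C₁ = (A₁+B₁) ∪ (A₂+B₂)`,
`C₂ = (A₂+B₁) ∪ (A₁+B₂)`): Case III.1 (`A = {0,1,2,u}`, `B = {0,1,2,v}`): `|C₁| = 5`, `|C₂| = 3` force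
`u + v ∈ {0,…,4}` and `u = v`, and `false_of_three_one` ends it; Case III.2 (`A = {0,1,u,u+1}`,
`B = {0,1,2,v}`) and its mirror: `|C₁| = |C₂| = 4` give `u + v, v − u ∈ {0, 1, 2}` (resp. `u − v`), so again
`2v` (resp. `2u`) `∈ {0,…,4}`; Case III.3 (`A = {0,1,u,u+1}`, `B = {0,1,v,v+1}`): `(|C₁|, |C₂|) ∈
{(5,3), (4,4), (3,5)}` gives `u + v = ±(|C₁| − 3)`, `v − u = ±(|C₂| − 3)`, whence `v ∈ {0, ±1}`, impossible.
(All in units of `d`; the runs of `A` and `B` are ordered longer-first w.l.o.g.)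
[cite: HamidouneRodseth2000, §4 Lemma 8, Case III (pp. 260–261)] -/
theorem false_of_card_four {A B : Finset (ZMod p)} {d a₁ a₂ b₁ b₂ : ZMod p} (hd : d ≠ 0)
    {n₁ n₂ m₁ m₂ : ℕ} (hA : A = apFinset a₁ d n₁ ∪ apFinset a₂ d n₂) (hn₁ : 1 ≤ n₁) (hn₂ : 1 ≤ n₂)
    (hcardA : n₁ + n₂ = #A) (hAdisj : Disjoint (apFinset a₁ d n₁) (apFinset a₂ d n₂))
    (hA2 : #((d +ᵥ A) \ A) = 2)
    (hB : B = apFinset b₁ d m₁ ∪ apFinset b₂ d m₂) (hm₁ : 1 ≤ m₁) (hm₂ : 1 ≤ m₂)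
    (hcardB : m₁ + m₂ = #B) (hBdisj : Disjoint (apFinset b₁ d m₁) (apFinset b₂ d m₂))
    (hB2 : #((d +ᵥ B) \ B) = 2) (hA4 : #A = 4) (hB4 : #B = 4)
    (hAna : ∀ e a : ZMod p, e ≠ 0 → ¬ A ⊆ apFinset a e (#A + 1))
    (hBna : ∀ e b : ZMod p, e ≠ 0 → ¬ B ⊆ apFinset b e (#B + 1))
    (hAB : #(A + B) = #A + #B) (hp4 : #(A + B) + 4 ≤ p) : False := by
  -- order the runs of `A` and of `B` longer-first
  wlog hnle : n₂ ≤ n₁ generalizing a₁ a₂ n₁ n₂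
  · exact this (hA.trans (union_comm _ _)) hn₂ hn₁ (by omega) hAdisj.symm (by omega)
  wlog hmle : m₂ ≤ m₁ generalizing b₁ b₂ m₁ m₂
  · exact this (hB.trans (union_comm _ _)) hm₂ hm₁ (by omega) hBdisj.symm (by omega)
  have hp3 : 3 ≤ p := by omega
  have hXu : A + B ≠ univ := ne_univ_of_card_lt (by omega)
  rw [hA4] at hAna
  rw [hB4] at hBna
  obtain ⟨c₁, c₂, L₁, L₂, hL₁, hL₂, hLsum, hXeq, hDdisj, hC₁, hC₂⟩ :=
    components_of_double_double hd hA hn₁ hn₂ hcardA hA2 (fun a => by rw [hA4]; exact hAna d a hd) hB hm₁ hm₂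
      hcardB hB2 (fun b => by rw [hB4]; exact hBna d b hd) (by omega) hAB hp4
  have hL₁p : L₁ < p := by omega
  have hL₂p : L₂ < p := by omega
  -- the four pieces are runs
  have hA₁A : apFinset a₁ d n₁ ⊆ A := by rw [hA]; exact subset_union_left
  have hA₂A : apFinset a₂ d n₂ ⊆ A := by rw [hA]; exact subset_union_right
  have hB₁B : apFinset b₁ d m₁ ⊆ B := by rw [hB]; exact subset_union_left
  have hB₂B : apFinset b₂ d m₂ ⊆ B := by rw [hB]; exact subset_union_right
  have run : ∀ (a b : ZMod p) (n m : ℕ), 1 ≤ n → 1 ≤ m → apFinset a d n ⊆ A → apFinset b d m ⊆ B →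
      apFinset a d n + apFinset b d m = apFinset (a + b) d (n + m - 1) := fun a b n m hn hm hPA hQB =>
    (apFinset_add_apFinset_eq hd hn hm (fun h => hXu (eq_univ_of_subset (add_subset_add hPA hQB) h))).1
  rw [run a₁ b₁ n₁ m₁ hn₁ hm₁ hA₁A hB₁B, run a₂ b₂ n₂ m₂ hn₂ hm₂ hA₂A hB₂B] at hC₁
  rw [run a₂ b₁ n₂ m₁ hn₂ hm₁ hA₂A hB₁B, run a₁ b₂ n₁ m₂ hn₁ hm₂ hA₁A hB₂B] at hC₂
  -- separation of the runs inside `A` and inside `B`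
  have ha₂ : a₂ ∉ apFinset a₁ d n₁ :=
    fun h => disjoint_right.1 hAdisj (mem_apFinset.2 ⟨0, hn₂, by simp⟩) h
  have ha₁ : a₁ ∉ apFinset a₂ d n₂ :=
    fun h => disjoint_left.1 hAdisj (mem_apFinset.2 ⟨0, hn₁, by simp⟩) h
  have hb₂ : b₂ ∉ apFinset b₁ d m₁ :=
    fun h => disjoint_right.1 hBdisj (mem_apFinset.2 ⟨0, hm₂, by simp⟩) h
  have hb₁ : b₁ ∉ apFinset b₂ d m₂ :=
    fun h => disjoint_left.1 hBdisj (mem_apFinset.2 ⟨0, hm₁, by simp⟩) h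
  -- shapes: `(3,1)` or `(2,2)` on each side
  rcases (show (n₁ = 3 ∧ n₂ = 1) ∨ (n₁ = 2 ∧ n₂ = 2) by omega) with ⟨rfl, rfl⟩ | ⟨rfl, rfl⟩ <;>
    rcases (show (m₁ = 3 ∧ m₂ = 1) ∨ (m₁ = 2 ∧ m₂ = 2) by omega) with ⟨rfl, rfl⟩ | ⟨rfl, rfl⟩
  · -- Case III.1: `A = {0,1,2,u}`, `B = {0,1,2,v}`
    norm_num at hC₁ hC₂
    obtain ⟨i, hi, hi5⟩ := exists_offset_of_apFinset_subset hd (by norm_num) hL₁p (hC₁ ▸ subset_union_left)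
    obtain ⟨t, ht, ht1⟩ := exists_offset_of_apFinset_subset hd (by norm_num) hL₁p (hC₁ ▸ subset_union_right)
    obtain ⟨j, -, hj3⟩ := exists_offset_of_apFinset_subset hd (by norm_num) hL₂p (hC₂ ▸ subset_union_left)
    have hL₂3 : L₂ = 3 := by omega
    subst hL₂3
    have hi0 : i = 0 := by omega
    subst hi0
    rw [zero_nsmul, add_zero] at hi
    rw [apFinset_one] at hB
    refine false_of_three_one hd hp3 hB hb₂ hBna (t := t) (by omega) ?_
    rcases offset_of_union_three_three hd hL₂p hC₂.symm with h | h
    · simp only [Nat.sub_self, zero_nsmul, add_zero] at h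
      linear_combination ht - hi + h
    · simp only [Nat.sub_self, zero_nsmul, add_zero] at h
      linear_combination ht - hi - h
  · -- Case III.2 mirrored: `A = {0,1,2,u}`, `B = {0,1,v,v+1}` — the computation lands on `A`
    norm_num at hC₁ hC₂
    obtain ⟨i, hi, hi4⟩ := exists_offset_of_apFinset_subset hd (by norm_num) hL₁p (hC₁ ▸ subset_union_left)
    obtain ⟨t, ht, ht2⟩ := exists_offset_of_apFinset_subset hd (by norm_num) hL₁p (hC₁ ▸ subset_union_right)
    obtain ⟨j, hj, hj2⟩ := exists_offset_of_apFinset_subset hd (by norm_num) hL₂p (hC₂ ▸ subset_union_left)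
    obtain ⟨l, hl, hl4⟩ := exists_offset_of_apFinset_subset hd (by norm_num) hL₂p (hC₂ ▸ subset_union_right)
    have hi0 : i = 0 := by omega
    have hl0 : l = 0 := by omega
    subst hi0 hl0
    rw [zero_nsmul, add_zero] at hi hl
    rw [apFinset_one] at hA
    refine false_of_three_one hd hp3 hA ha₂ hAna (t := t + j) (by omega) ?_
    rw [add_nsmul]
    linear_combination ht - hi + hj - hl
  · -- Case III.2: `A = {0,1,u,u+1}`, `B = {0,1,2,v}`
    norm_num at hC₁ hC₂
    obtain ⟨i, hi, hi4⟩ := exists_offset_of_apFinset_subset hd (by norm_num) hL₁p (hC₁ ▸ subset_union_left)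
    obtain ⟨t, ht, ht2⟩ := exists_offset_of_apFinset_subset hd (by norm_num) hL₁p (hC₁ ▸ subset_union_right)
    obtain ⟨j, hj, hj4⟩ := exists_offset_of_apFinset_subset hd (by norm_num) hL₂p (hC₂ ▸ subset_union_left)
    obtain ⟨l, hl, hl2⟩ := exists_offset_of_apFinset_subset hd (by norm_num) hL₂p (hC₂ ▸ subset_union_right)
    have hi0 : i = 0 := by omega
    have hj0 : j = 0 := by omega
    subst hi0 hj0
    rw [zero_nsmul, add_zero] at hi hj
    rw [apFinset_one] at hB
    refine false_of_three_one hd hp3 hB hb₂ hBna (t := t + l) (by omega) ?_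
    rw [add_nsmul]
    linear_combination ht - hi + hl - hj
  · -- Case III.3: `A = {0,1,u,u+1}`, `B = {0,1,v,v+1}`
    norm_num at hC₁ hC₂
    have hv0 : b₂ - b₁ ≠ 0 := fun h => hb₂ (mem_apFinset.2 ⟨0, by norm_num, by
      rw [zero_nsmul, add_zero]; exact (sub_eq_zero.1 h).symm⟩)
    have hvd : b₂ - b₁ ≠ d := fun h => hb₂ (mem_apFinset.2 ⟨1, by norm_num, by
      rw [one_nsmul, ← h, add_sub_cancel]⟩)
    have hvn : b₂ - b₁ ≠ -d := fun h => hb₁ (mem_apFinset.2 ⟨1, by norm_num, by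
      rw [one_nsmul]; linear_combination h⟩)
    obtain ⟨i, -, hi3⟩ := exists_offset_of_apFinset_subset hd (by norm_num) hL₁p (hC₁ ▸ subset_union_left)
    obtain ⟨j, -, hj3⟩ := exists_offset_of_apFinset_subset hd (by norm_num) hL₂p (hC₂ ▸ subset_union_left)
    obtain ⟨k₁, rfl⟩ : ∃ k, L₁ = k + 3 := ⟨L₁ - 3, by omega⟩
    obtain ⟨k₂, rfl⟩ : ∃ k, L₂ = k + 3 := ⟨L₂ - 3, by omega⟩
    have h1 := offset_of_union_three_three hd hL₁p hC₁.symm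
    have h2 := offset_of_union_three_three hd hL₂p hC₂.symm
    rw [Nat.add_sub_cancel] at h1 h2
    rcases (show (k₁ = 0 ∧ k₂ = 2) ∨ (k₁ = 1 ∧ k₂ = 1) ∨ (k₁ = 2 ∧ k₂ = 0) by omega) with
      ⟨rfl, rfl⟩ | ⟨rfl, rfl⟩ | ⟨rfl, rfl⟩
    · rcases h1 with h1 | h1 <;> rcases h2 with h2 | h2
      · exact hvd (eq_of_add_self_eq hp3 (by linear_combination h1 + h2))
      · exact hvn (eq_of_add_self_eq hp3 (by linear_combination h1 - h2))
      · exact hvd (eq_of_add_self_eq hp3 (by linear_combination (-1 : ZMod p) * h1 + h2))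
      · exact hvn (eq_of_add_self_eq hp3 (by linear_combination (-1 : ZMod p) * h1 - h2))
    · rcases h1 with h1 | h1 <;> rcases h2 with h2 | h2
      · exact hvd (eq_of_add_self_eq hp3 (by linear_combination h1 + h2))
      · exact hv0 (eq_of_add_self_eq hp3 (by linear_combination h1 - h2))
      · exact hv0 (eq_of_add_self_eq hp3 (by linear_combination (-1 : ZMod p) * h1 + h2))
      · exact hvn (eq_of_add_self_eq hp3 (by linear_combination (-1 : ZMod p) * h1 - h2))
    · rcases h1 with h1 | h1 <;> rcases h2 with h2 | h2
      · exact hvd (eq_of_add_self_eq hp3 (by linear_combination h1 + h2))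
      · exact hvd (eq_of_add_self_eq hp3 (by linear_combination h1 - h2))
      · exact hvn (eq_of_add_self_eq hp3 (by linear_combination (-1 : ZMod p) * h1 + h2))
      · exact hvn (eq_of_add_self_eq hp3 (by linear_combination (-1 : ZMod p) * h1 - h2))

/-! ## Theorem 3 -/

/-- Stripping `{0, d}` off a double progression whose components both have at least two points (§5, p. 261:
"`A = {0,1} + A′`, where `A′` is a double 1-progression with `|A′| = |A| − 2`").
[cite: HamidouneRodseth2000, §5 (p. 261)] -/
theorem exists_strip_pair {A : Finset (ZMod p)} {d a₁ a₂ : ZMod p} (hd : d ≠ 0) {n₁ n₂ : ℕ}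
    (hA : A = apFinset a₁ d n₁ ∪ apFinset a₂ d n₂) (hn₁ : 2 ≤ n₁) (hn₂ : 2 ≤ n₂) (hcardA : n₁ + n₂ = #A)
    (hAp : #A ≤ p) :
    apFinset a₁ d (n₁ - 1) ∪ apFinset a₂ d (n₂ - 1) + ({0, d} : Finset (ZMod p)) = A ∧
      #(apFinset a₁ d (n₁ - 1) ∪ apFinset a₂ d (n₂ - 1)) = #A - 2 := by
  have hdisj : Disjoint (apFinset a₁ d n₁) (apFinset a₂ d n₂) :=
    disjoint_of_card_union_eq hd (by omega) (by omega) (by rw [← hA]; omega)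
  constructor
  · rw [union_add, apFinset_add_pair_zero (by omega : 1 ≤ n₁ - 1), apFinset_add_pair_zero (by omega : 1 ≤ n₂ - 1),
      Nat.sub_add_cancel (by omega : 1 ≤ n₁), Nat.sub_add_cancel (by omega : 1 ≤ n₂), hA]
  · have hdisj' : Disjoint (apFinset a₁ d (n₁ - 1)) (apFinset a₂ d (n₂ - 1)) :=
      hdisj.mono (Isoperimetric.apFinset_mono a₁ d (by omega)) (Isoperimetric.apFinset_mono a₂ d (by omega))
    rw [card_union_of_disjoint hdisj', card_apFinset hd (by omega), card_apFinset hd (by omega)]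
    omega

/-- A set with at most one `d`-run is an almost `d`-progression (indeed a progression).
[cite: HamidouneRodseth2000, §1 (p. 251: "an arithmetic progression is also an almost-progression")] -/
theorem subset_apFinset_succ_of_runs_le_one {X : Finset (ZMod p)} {d : ZMod p} (hd : d ≠ 0) (hXu : X ≠ univ)
    (h1 : #((d +ᵥ X) \ X) ≤ 1) : ∃ a : ZMod p, X ⊆ apFinset a d (#X + 1) := by
  obtain ⟨s, hs, -⟩ := Isoperimetric.exists_eq_apFinset_of_card_vadd_sdiff_le_one hd hXu h1
  exact ⟨s, hs.le.trans (Isoperimetric.apFinset_mono s d (by omega))⟩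

/-- **Theorem 3 of Hamidoune–Rødseth, modulo its `|S| = 3` layer** (statement p. 252, proof §5 p. 261):
"Suppose that `|A|, |B| ≥ 3`, and that `7 ≤ |A + B| = |A| + |B| ≤ p − 4`.  Then `A` and `B` are
almost-progressions with the same difference."  Here: IF the conclusion holds for every such pair with
`|A| = 3` (hypothesis `h3` — this is Lemma 8, Cases I and II, of the printed proof, together with the
`|A| = 3` case of Lemma 4 (iii)/Lemma 5), THEN it holds for all `|A|, |B| ≥ 3`: there are `e ≠ 0` and
`a, b` with `A ⊆ {a, a + e, …, a + |A| e}` and `B ⊆ {b, b + e, …, b + |B| e}`.  Proof = the printed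
induction on `|A| + |B|` (§5): for a pair with `|A| ≥ |B| ≥ 4` which is not of the wanted form, Lemma 5
shows that neither set is an almost progression for any difference; Theorem 5 (tree:
`Isoperimetric.exists_card_vadd_sdiff_le_two_of_card_add_eq`) makes `A` a double `d`-progression and
Lemma 4 makes `B` one; `|A| + |B| = 8` is Case III of Lemma 8 (`false_of_card_four`); otherwise `|A| ≥ 5`,
Lemma 6 gives both components of `A` at least two points, `A = {0,d} + A′`, the number `k` of components of
`A′ + B` is `2` (Cauchy–Davenport and Vosper exclude `|A′ + B| = |A′| + |B| − 1`, Lemma 3 excludes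
`k = 1`), so `7 ≤ |A′ + B| = |A′| + |B| ≤ p − 6` and the induction hypothesis makes `B` an almost
progression — a contradiction.
[cite: HamidouneRodseth2000, Theorem 3 (p. 252) and §5 (p. 261)] -/
theorem hamidouneRodseth_of_card_three
    (h3 : ∀ A B : Finset (ZMod p), #A = 3 → 3 ≤ #B → 7 ≤ #(A + B) → #(A + B) = #A + #B →
      #(A + B) + 4 ≤ p → ∃ e a b : ZMod p, e ≠ 0 ∧ A ⊆ apFinset a e (#A + 1) ∧ B ⊆ apFinset b e (#B + 1))
    {A B : Finset (ZMod p)} (hA3 : 3 ≤ #A) (hB3 : 3 ≤ #B) (h7 : 7 ≤ #(A + B)) (hAB : #(A + B) = #A + #B)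
    (hp4 : #(A + B) + 4 ≤ p) :
    ∃ e a b : ZMod p, e ≠ 0 ∧ A ⊆ apFinset a e (#A + 1) ∧ B ⊆ apFinset b e (#B + 1) := by
  -- strong induction on `|A| + |B|`
  suffices main : ∀ (N : ℕ) (A B : Finset (ZMod p)), #A + #B = N → 3 ≤ #A → 3 ≤ #B → 7 ≤ #(A + B) →
      #(A + B) = #A + #B → #(A + B) + 4 ≤ p →
      ∃ e a b : ZMod p, e ≠ 0 ∧ A ⊆ apFinset a e (#A + 1) ∧ B ⊆ apFinset b e (#B + 1) from
    main _ A B rfl hA3 hB3 h7 hAB hp4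
  intro N
  induction N using Nat.strong_induction_on with
  | _ N ih =>
  intro A B hN hA3 hB3 h7 hAB hp4
  -- the symmetric data
  have h7' : 7 ≤ #(B + A) := by rwa [add_comm B A]
  have hAB' : #(B + A) = #B + #A := by rw [add_comm B A, hAB, Nat.add_comm]
  have hp4' : #(B + A) + 4 ≤ p := by rwa [add_comm B A]
  -- w.l.o.g. `|B| ≤ |A|`
  wlog hle : #B ≤ #A generalizing A B
  · obtain ⟨e, b, a, he, hb, ha⟩ := this B A (by omega) hB3 hA3 h7' hAB' hp4' h7 hAB hp4 (by omega)
    exact ⟨e, a, b, he, ha, hb⟩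
  -- `|B| = 3`: the hypothesis
  by_cases hB3' : #B = 3
  · obtain ⟨e, b, a, he, hb, ha⟩ := h3 B A hB3' hA3 h7' hAB' hp4'
    exact ⟨e, a, b, he, ha, hb⟩
  have hB4 : 4 ≤ #B := by omega
  have hA4 : 4 ≤ #A := by omega
  have hAne : A.Nonempty := card_pos.1 (by omega)
  have hBne : B.Nonempty := card_pos.1 (by omega)
  have hXu : A + B ≠ univ := ne_univ_of_card_lt (by omega)
  -- if `A` or `B` is an almost progression: Lemma 5
  by_cases hAal : ∃ e a : ZMod p, e ≠ 0 ∧ A ⊆ apFinset a e (#A + 1)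
  · obtain ⟨e, a, he, ha⟩ := hAal
    exact common_of_subset_apFinset he hA4 (by omega) hAB hp4 ha
  by_cases hBal : ∃ e b : ZMod p, e ≠ 0 ∧ B ⊆ apFinset b e (#B + 1)
  · obtain ⟨e, b, he, hb⟩ := hBal
    obtain ⟨e', b', a', he', hb', ha'⟩ := common_of_subset_apFinset he hB4 (by omega) hAB' hp4' hb
    exact ⟨e', a', b', he', ha', hb'⟩
  push Not at hAal hBal
  exfalso
  -- `A` is a double `d`-progression (Theorem 5), with two components
  obtain ⟨d, hd, hdA⟩ := Isoperimetric.exists_card_vadd_sdiff_le_two_of_card_add_eq (A := B) (B := A) hB3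
    (by omega) hAB' hp4'
  have hAu : A ≠ univ := ne_univ_of_card_lt (by omega)
  have hA2 : #((d +ᵥ A) \ A) = 2 := by
    by_contra h
    obtain ⟨a, ha⟩ := subset_apFinset_succ_of_runs_le_one hd hAu (by omega)
    exact hAal d a hd ha
  obtain ⟨a₁, a₂, n₁, n₂, hn₁, hn₂, hnsum, hAeq, hAdisj, -⟩ := exists_two_components hd hA2
  -- Lemma 4: `B` is a double `d`-progression, with two components
  have hBu : B ≠ univ := ne_univ_of_card_lt (by omega)
  have hB2 : #((d +ᵥ B) \ B) = 2 := by
    rcases runs_le_two_or_common_of_two_runs hd hAeq hn₁ hn₂ hnsum (by omega) hBne hAB hp4 with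
      hk | ⟨e, a, b, he, ha, -⟩ | ⟨h3', -⟩
    · by_contra h
      obtain ⟨b, hb⟩ := subset_apFinset_succ_of_runs_le_one hd hBu (by omega)
      exact hBal d b hd hb
    · exact absurd ha (hAal e a he)
    · omega
  obtain ⟨b₁, b₂, m₁, m₂, hm₁, hm₂, hmsum, hBeq, hBdisj, -⟩ := exists_two_components hd hB2
  have hAna : ∀ a : ZMod p, ¬ A ⊆ apFinset a d (#A + 1) := fun a => hAal d a hd
  have hBna : ∀ b : ZMod p, ¬ B ⊆ apFinset b d (#B + 1) := fun b => hBal d b hd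
  -- `|A| + |B| = 8`: Case III of Lemma 8
  by_cases hN8 : #A + #B = 8
  · exact false_of_card_four hd hAeq hn₁ hn₂ hnsum hAdisj hA2 hBeq hm₁ hm₂ hmsum hBdisj hB2 (by omega)
      (by omega) hAal hBal hAB hp4
  -- `|A| ≥ 5`: both components of `A` have at least two points (Lemma 6)
  have hA5 : 5 ≤ #A := by omega
  have h61 := two_mul_le_card_add_two hd hAeq hn₁ hn₂ hnsum hBeq hm₁ hm₂ hmsum hB2 hBna hAB hp4
  have h62 := two_mul_le_card_add_two hd (hAeq.trans (union_comm _ _)) hn₂ hn₁ (by omega) hBeq hm₁ hm₂ hmsum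
    hB2 hBna hAB hp4
  have hn₁2 : 2 ≤ n₁ := by omega
  have hn₂2 : 2 ≤ n₂ := by omega
  -- strip `{0, d}`
  obtain ⟨hA'T, hcA'⟩ := exists_strip_pair hd hAeq hn₁2 hn₂2 hnsum (by omega)
  set A' := apFinset a₁ d (n₁ - 1) ∪ apFinset a₂ d (n₂ - 1) with hA'
  set X' := A' + B with hX'
  have hXeq : A + B = X' + {0, d} := by rw [hX', ← hA'T, add_right_comm]
  have hcX : #(A + B) = #X' + #((d +ᵥ X') \ X') := by rw [hXeq]; exact Isoperimetric.card_add_pair_zero_eq X' d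
  have hX'sub : X' ⊆ A + B := by rw [hXeq]; exact subset_add_left _ (by simp)
  have hX'u : X' ≠ univ := fun h => hXu (eq_univ_of_subset hX'sub h)
  have hA'ne : A'.Nonempty := card_pos.1 (by omega)
  have hX'ne : X'.Nonempty := hA'ne.add hBne
  have hcd := Vosper.cauchy_davenport_of_ne_univ hA'ne hBne hX'u
  have hX'def : #(A' + B) = #X' := rfl
  -- `|X′| = |A′| + |B| − 1` is excluded by Vosper (then `B` would be a progression)
  have hX'ge : #A' + #B ≤ #X' := by
    by_contra hlt
    obtain ⟨e, he, -, hBe⟩ := vosper_inverse (A := A') (B := B) (by omega) (by omega) (by omega) (by omega)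
    obtain ⟨b, hb⟩ := hBe
    exact hBal e b he (hb.le.trans (Isoperimetric.apFinset_mono b e (by omega)))
  have hk1 := Isoperimetric.one_le_card_vadd_sdiff hX'ne hX'u hd
  -- `k = 1` is excluded by Lemma 3 (then `A + B` would be a progression)
  have hk2 : #((d +ᵥ X') \ X') = 2 := by
    rcases (show #((d +ᵥ X') \ X') = 1 ∨ #((d +ᵥ X') \ X') = 2 by omega) with h | h
    · exfalso
      obtain ⟨x, hx, -⟩ := Isoperimetric.exists_eq_apFinset_of_card_vadd_sdiff_le_one hd hX'u (by omega)
      have hXrun : A + B = apFinset x d (#X' + 1) := by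
        rw [hXeq, hx, card_apFinset hd (by omega), apFinset_add_pair_zero (by omega)]
      have hAP : IsAP (A + B) d := ⟨x, by rw [hXrun, card_apFinset hd (by omega)]⟩
      obtain ⟨a, ha⟩ := subset_apFinset_of_isAP_add hd hAne hBne hAP hAB.le (by omega)
      exact hAna a ha
    · exact h
  -- the induction hypothesis for `(A′, B)`
  have hX'c : #X' = #A' + #B := by omega
  obtain ⟨e, a, b, he, -, hb⟩ := ih (#A' + #B) (by omega) A' B rfl (by omega) (by omega) (by omega) hX'c
    (by omega)
  exact hBal e b he hb

end HamidouneRodseth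

end Literature.Combinatorics.Additive
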